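import Mathlib
import Literature.Combinatorics.Optimization.ReflectionRelations
import HarnessLib

/-!
# The parity polytopes have extended formulations with `4(n − 1)` inequalities
# (Kaibel–Pashkovich 2011, §4.1.4; Carr–Konjevod), and need `n − 1` (Goemans) — PROVED

Source: V. Kaibel, K. Pashkovich, *Constructing extended formulations from reflection relations*,
IPCO 2011 [KaibelPashkovich2011] (held text `paper:arxiv-1011.3597`, §4.1.4, arXiv p. 11). Verbatim:
"The group `D_n` is generated by the reflections in `ℝⁿ` at the hyperplanes `H^=(e_k + e_ℓ, 0)` and
`H^=(e_k − e_ℓ, 0)` for all pairwise distinct `k, ℓ ∈ [n]`. … The orbit of a point `x ∈ ℝⁿ` under the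
action of `D_n` consists of all points which can be obtained from `x` by permuting its coordinates and
changing the signs of an even number of its coordinates. … For `k, ℓ ∈ [n]` with `k ≠ ℓ`, we denote the
ordered pair `(R_{e_k − e_ℓ, 0}, R_{−e_k − e_ℓ, 0})` of reflection relations by `E_{k,ℓ}`. … If we
restrict attention to the polytopes `P = {(−1, 1, …, 1)} ⊆ ℝⁿ` and `P = {(1, 1, …, 1)} ⊆ ℝⁿ`, then we can
remove the reflection relations `T_{i_1,j_1}, …, T_{i_r,j_r}` from the construction in Proposition 7.
Thus, we obtain extended formulations with `2(n − 1)` variables and `4(n − 1)` inequalities of the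
convex hulls of all vectors in `{−1,+1}ⁿ` with an odd respectively even number of ones. Thus, applying
the affine transformation of `ℝⁿ` given by `y ↦ ½(𝟙 − y)`, we derive extended formulations with
`2(n − 1)` variables and `4(n − 1)` inequalities for the parity polytopes `conv{v ∈ {0,1}ⁿ : Σ_i v_i odd}`
and `conv{v ∈ {0,1}ⁿ : Σ_i v_i even}`, respectively (reproving a result by Carr and Konjevod [CK04])."

## What is proved (no named fact), on top of `ReflectionRelations.lean` (Theorem 1, Remark 2)

* `signVecsEven n` / `signVecsOdd n`: the vectors of `{−1,+1}ⁿ` with `∏ x_i = 1` resp. `−1`, i.e. with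
  an even resp. odd number of entries `−1` (`mem_signVecsEven_iff`, `mem_signVecsOdd_iff`) — the
  `D_n`-orbits of `𝟙` and of `(−1, 1, …, 1)`;
* `paritySeq m`: the sequence `(E_{1,2}, E_{2,3}, …, E_{m,m+1})` of `2m` reflection relations on
  `ℝ^{m+1}` (`length_paritySeq`), and the heart of Proposition 7 for these two points:
  `canonSeq_paritySeq : ϱ* ∘ ⋯ ∘ ϱ*(w) = (∏ w_i, 1, …, 1)` for every `w ∈ {−1,+1}^{m+1}` (the composite
  canonical map `η*_{1,2} ∘ ⋯ ∘ η*_{m,m+1}` pushes all signs into the first coordinate);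
* `seqImage_paritySeq_even` / `_odd`: the sequence maps the point `𝟙` onto `conv(signVecsEven)` and the
  point `(−1, 1, …, 1)` onto `conv(signVecsOdd)` (Theorem 1 of `ReflectionRelations.lean`);
* **`hasEFOfSize_convexHull_signVecsEven/Odd : HasEFOfSize (conv signVecs… (m+1)) (4m)`** — the printed
  `4(n − 1)` inequalities for `n = m + 1 ≥ 1`;
* the 0/1 **parity polytopes** `parityPolytope n odd? = conv{v ∈ {0,1}ⁿ : #{i : v_i = 1} odd / even}`
  and **`hasEFOfSize_parityPolytope : HasEFOfSize (parityPolytope (m+1) b) (4m)`** through the affine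
  map `y ↦ ½(𝟙 − y)` (`halfFlip`, `halfFlip_image_signVecs`), using the tree's lossless
  `HasEFOfSize.image_affine`;
* the matching-order **lower bound** by Goemans' face counting (every sign vector is a vertex,
  `signVec_mem_extremePoints`; `2^{n−1}` vertices need `2^{n−1} ≤ 2^r` faces):
  `le_of_hasEFOfSize_signVecsEven/Odd`, **`le_of_hasEFOfSize_parityPolytope : HasEFOfSize
  (parityPolytope (m+1) b) r → m ≤ r`** — so `n − 1 ≤ xc(parity polytope) ≤ 4(n − 1)`.

Deviations from print. (i) "with an odd respectively even number of ONES" on the `{−1,+1}` side is a slip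
of the extended abstract: the `D_n`-orbit of `(−1, 1, …, 1)` is the set of sign vectors with an odd
number of MINUS ones (for even `n` the two readings differ), and `y ↦ ½(𝟙 − y)` sends minus ones to
ones; we state the `{−1,+1}` results with the number of entries `−1` (equivalently the sign of `∏ y_i`)
and the `{0,1}` results exactly as printed. (ii) The number of VARIABLES (`2(n − 1)`) is not tracked by the
tree's `HasEFOfSize` (inequalities only). (iii) Proposition 7 / Theorem 6 for a general polytope (with
the sorting-network prefix) are not formalised here; only the two one-point cases the text singles out.
Yannakakis' lower-bound discussion of the parity polytope in the original space (exponentially many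
facets) is context only. Honest framing: Literature infrastructure on extended formulations; nothing
here bears on `P ≠ NP`.
-/

noncomputable section

namespace Literature.Combinatorics.Optimization

namespace ParityPolytope

open Matrix Finset Literature.Barriers.PneNP

variable {m n : ℕ}

/-! ### Sign vectors and their parity -/

/-- `{−1,+1}ⁿ`. [cite: KaibelPashkovich2011, §4.1.4 (arXiv p. 11)] -/
def IsSignVec (x : Fin n → ℝ) : Prop := ∀ i, x i = 1 ∨ x i = -1

/-- The `D_n`-orbit of `𝟙`: sign vectors with an even number of entries `−1`, written as `∏ x_i = 1`
(`mem_signVecsEven_iff`). [cite: KaibelPashkovich2011, §4.1.4 (arXiv p. 11)] -/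
def signVecsEven (n : ℕ) : Set (Fin n → ℝ) := {x | IsSignVec x ∧ ∏ i, x i = 1}

/-- The `D_n`-orbit of `(−1, 1, …, 1)`: sign vectors with an odd number of entries `−1` (`∏ x_i = −1`,
`mem_signVecsOdd_iff`). [cite: KaibelPashkovich2011, §4.1.4 (arXiv p. 11)] -/
def signVecsOdd (n : ℕ) : Set (Fin n → ℝ) := {x | IsSignVec x ∧ ∏ i, x i = -1}

/-- For a sign vector, `∏ x_i = (−1)^{#{i : x_i = −1}}`. [cite: KaibelPashkovich2011, §4.1.4 (arXiv p. 11: "changing the signs of an even number of its coordinates")] -/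
theorem prod_eq_neg_one_pow {x : Fin n → ℝ} (hx : IsSignVec x) :
    ∏ i, x i = (-1) ^ (univ.filter fun i => x i = -1).card := by
  have : ∀ i ∈ (univ : Finset (Fin n)), x i = if x i = -1 then -1 else 1 := by
    intro i _
    rcases hx i with h | h
    · rw [h]; norm_num
    · rw [h]; norm_num
  rw [Finset.prod_congr rfl this, Finset.prod_ite, Finset.prod_const_one, mul_one, Finset.prod_const]

/-- A product of signs is a sign. [cite: KaibelPashkovich2011, §4.1.4 (arXiv p. 11)] -/
theorem prod_sign {x : Fin n → ℝ} (hx : IsSignVec x) : ∏ i, x i = 1 ∨ ∏ i, x i = -1 := by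
  rw [prod_eq_neg_one_pow hx]
  rcases Nat.even_or_odd (univ.filter fun i => x i = -1).card with h | h
  · exact Or.inl h.neg_one_pow
  · exact Or.inr h.neg_one_pow

/-- `signVecsEven` = "an even number of" entries `−1`. [cite: KaibelPashkovich2011, §4.1.4 (arXiv p. 11)] -/
theorem mem_signVecsEven_iff {x : Fin n → ℝ} :
    x ∈ signVecsEven n ↔ IsSignVec x ∧ Even (univ.filter fun i => x i = -1).card := by
  refine ⟨fun ⟨hx, hp⟩ => ⟨hx, ?_⟩, fun ⟨hx, he⟩ => ⟨hx, ?_⟩⟩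
  · rw [prod_eq_neg_one_pow hx] at hp
    exact (neg_one_pow_eq_one_iff_even (by norm_num)).1 hp
  · rw [prod_eq_neg_one_pow hx]
    exact he.neg_one_pow

/-- `signVecsOdd` = "an odd number of" entries `−1`. [cite: KaibelPashkovich2011, §4.1.4 (arXiv p. 11)] -/
theorem mem_signVecsOdd_iff {x : Fin n → ℝ} :
    x ∈ signVecsOdd n ↔ IsSignVec x ∧ Odd (univ.filter fun i => x i = -1).card := by
  refine ⟨fun ⟨hx, hp⟩ => ⟨hx, ?_⟩, fun ⟨hx, ho⟩ => ⟨hx, ?_⟩⟩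
  · rw [prod_eq_neg_one_pow hx] at hp
    rcases Nat.even_or_odd (univ.filter fun i => x i = -1).card with h | h
    · rw [h.neg_one_pow] at hp; norm_num at hp
    · exact h
  · rw [prod_eq_neg_one_pow hx]
    exact ho.neg_one_pow

/-! ### The pair `E_{1,2}` on the first two coordinates of `ℝ^{m+2}` -/

/-- The normal vector `e_1 − e_2` of `T_{1,2} = R_{e_1 − e_2, 0}` (first relation of `E_{1,2}`).
[cite: KaibelPashkovich2011, §4.1.4 (arXiv p. 11)] -/
def tNormal (m : ℕ) : Fin (m + 2) → ℝ := Pi.single 0 1 - Pi.single 1 1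

/-- The normal vector `−e_1 − e_2` of `R_{−e_1 − e_2, 0}` (second relation of `E_{1,2}`).
[cite: KaibelPashkovich2011, §4.1.4 (arXiv p. 11)] -/
def eNormal (m : ℕ) : Fin (m + 2) → ℝ := -Pi.single 0 1 - Pi.single 1 1

/-- `1 ≠ 0` in `Fin (m + 2)`. [folklore] -/
private theorem one_ne_zero_fin : (1 : Fin (m + 2)) ≠ 0 := by
  simp

/-- `k + 2 ≠ 1` in `Fin (m + 2)`. [folklore] -/
private theorem succ_succ_ne_one_fin (k : Fin m) : (k.succ.succ : Fin (m + 2)) ≠ 1 := by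
  intro h
  have := congrArg Fin.val h
  rw [Fin.val_succ, Fin.val_succ, Fin.val_one] at this
  omega

/-- `⟨e_1 − e_2, y⟩ = y_1 − y_2`. [cite: KaibelPashkovich2011, §4.1.2 (arXiv p. 10)] -/
theorem tNormal_dotProduct (y : Fin (m + 2) → ℝ) : tNormal m ⬝ᵥ y = y 0 - y 1 := by
  simp [tNormal, sub_dotProduct, single_dotProduct]

/-- `⟨−e_1 − e_2, y⟩ = −y_1 − y_2`. [cite: KaibelPashkovich2011, §4.1.4 (arXiv p. 11)] -/
theorem eNormal_dotProduct (y : Fin (m + 2) → ℝ) : eNormal m ⬝ᵥ y = -y 0 - y 1 := by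
  simp [eNormal, sub_dotProduct, single_dotProduct, neg_dotProduct]

/-- `e_1 − e_2 ≠ 0`. [cite: KaibelPashkovich2011, §3 (arXiv p. 7: "`a ∈ ℝⁿ ∖ {0}`")] -/
theorem tNormal_ne_zero : tNormal m ≠ 0 := by
  intro h
  have := congrFun h 0
  rw [tNormal, Pi.sub_apply, Pi.single_eq_same, Pi.single_eq_of_ne one_ne_zero_fin.symm] at this
  norm_num at this

/-- `−e_1 − e_2 ≠ 0`. [cite: KaibelPashkovich2011, §3 (arXiv p. 7)] -/
theorem eNormal_ne_zero : eNormal m ≠ 0 := by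
  intro h
  have := congrFun h 0
  rw [eNormal, Pi.sub_apply, Pi.neg_apply, Pi.single_eq_same,
    Pi.single_eq_of_ne one_ne_zero_fin.symm] at this
  norm_num at this

/-- `τ_{1,2}` swaps the first two coordinates. [cite: KaibelPashkovich2011, §4.1.2 (arXiv p. 10)] -/
theorem reflectAt_tNormal (y : Fin (m + 2) → ℝ) :
    reflectAt (tNormal m) 0 y = Function.update (Function.update y 1 (y 0)) 0 (y 1) := by
  have h1 := tNormal_dotProduct y
  have h2 : tNormal m ⬝ᵥ tNormal m = 2 := by
    rw [tNormal_dotProduct, tNormal, Pi.sub_apply, Pi.sub_apply, Pi.single_eq_same, Pi.single_eq_same,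
      Pi.single_eq_of_ne one_ne_zero_fin.symm, Pi.single_eq_of_ne one_ne_zero_fin]
    norm_num
  ext i
  rw [reflectAt, h1, h2]
  simp only [Pi.add_apply, Pi.smul_apply, smul_eq_mul, tNormal, Pi.sub_apply]
  by_cases hi0 : i = 0
  · subst hi0
    rw [Function.update_self, Pi.single_eq_same, Pi.single_eq_of_ne one_ne_zero_fin.symm]
    ring
  · by_cases hi1 : i = 1
    · subst hi1
      rw [Function.update_of_ne one_ne_zero_fin, Function.update_self, Pi.single_eq_same,
        Pi.single_eq_of_ne one_ne_zero_fin]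
      ring
    · rw [Function.update_of_ne hi0, Function.update_of_ne hi1, Pi.single_eq_of_ne hi0,
        Pi.single_eq_of_ne hi1]
      ring

/-- The reflection at `H^=(−e_1 − e_2, 0)` is `ρ_{1,2} ∘ τ_{1,2}`: swap the first two coordinates and
negate both. [cite: KaibelPashkovich2011, Prop. 7, proof (arXiv p. 11: "`ρ_{k,ℓ}(y)` arises from `y` by multiplying both components `k` and `ℓ` by `−1`")] -/
theorem reflectAt_eNormal (y : Fin (m + 2) → ℝ) :
    reflectAt (eNormal m) 0 y = Function.update (Function.update y 1 (-y 0)) 0 (-y 1) := by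
  have h1 := eNormal_dotProduct y
  have h2 : eNormal m ⬝ᵥ eNormal m = 2 := by
    rw [eNormal_dotProduct, eNormal, Pi.sub_apply, Pi.sub_apply, Pi.neg_apply, Pi.neg_apply,
      Pi.single_eq_same, Pi.single_eq_same, Pi.single_eq_of_ne one_ne_zero_fin.symm,
      Pi.single_eq_of_ne one_ne_zero_fin]
    norm_num
  ext i
  rw [reflectAt, h1, h2]
  simp only [Pi.add_apply, Pi.smul_apply, smul_eq_mul, eNormal, Pi.sub_apply, Pi.neg_apply]
  by_cases hi0 : i = 0
  · subst hi0
    rw [Function.update_self, Pi.single_eq_same, Pi.single_eq_of_ne one_ne_zero_fin.symm]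
    ring
  · by_cases hi1 : i = 1
    · subst hi1
      rw [Function.update_of_ne one_ne_zero_fin, Function.update_self, Pi.single_eq_same,
        Pi.single_eq_of_ne one_ne_zero_fin]
      ring
    · rw [Function.update_of_ne hi0, Function.update_of_ne hi1, Pi.single_eq_of_ne hi0,
        Pi.single_eq_of_ne hi1]
      ring

/-- **`η*_{1,2} = τ*_{1,2} ∘ ϱ*_{−e_1−e_2}` on sign entries**: "the vector `y' ∈ {y, τ(y), ρ(y), ρ(τ(y))}`
with `|y'_1| ≤ y'_2`" — for `y_1, y_2 ∈ {±1}` it replaces `(y_1, y_2)` by `(y_1 y_2, 1)`.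
[cite: KaibelPashkovich2011, Prop. 7, proof (arXiv p. 11)] -/
theorem etaStar_sign (y : Fin (m + 2) → ℝ) (h0 : y 0 = 1 ∨ y 0 = -1) (h1 : y 1 = 1 ∨ y 1 = -1) :
    canon (tNormal m) 0 (canon (eNormal m) 0 y) =
      Function.update (Function.update y 1 1) 0 (y 0 * y 1) := by
  have hne := (one_ne_zero_fin (m := m))
  rcases h0 with h0 | h0 <;> rcases h1 with h1 | h1
  · -- (1, 1) ↦ (1, 1)
    have c1 : eNormal m ⬝ᵥ y ≤ 0 := by rw [eNormal_dotProduct, h0, h1]; norm_num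
    have c2 : tNormal m ⬝ᵥ y ≤ 0 := by rw [tNormal_dotProduct, h0, h1]; norm_num
    have hin : canon (eNormal m) 0 y = y := by rw [canon, if_pos c1]
    rw [hin, canon, if_pos c2]
    ext i
    by_cases hi0 : i = 0
    · subst hi0; rw [Function.update_self, h0, h1]; norm_num
    · rw [Function.update_of_ne hi0]
      by_cases hi1 : i = 1
      · subst hi1; rw [Function.update_self, h1]
      · rw [Function.update_of_ne hi1]
  · -- (1, −1) ↦ τ: (−1, 1)
    have c1 : eNormal m ⬝ᵥ y ≤ 0 := by rw [eNormal_dotProduct, h0, h1]; norm_num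
    have c2 : ¬ tNormal m ⬝ᵥ y ≤ 0 := by rw [tNormal_dotProduct, h0, h1]; norm_num
    have hin : canon (eNormal m) 0 y = y := by rw [canon, if_pos c1]
    rw [hin, canon, if_neg c2, reflectAt_tNormal]
    ext i
    by_cases hi0 : i = 0
    · subst hi0; rw [Function.update_self, Function.update_self, h0, h1]; norm_num
    · rw [Function.update_of_ne hi0, Function.update_of_ne hi0]
      by_cases hi1 : i = 1
      · subst hi1; rw [Function.update_self, Function.update_self, h0]
      · rw [Function.update_of_ne hi1, Function.update_of_ne hi1]
  · -- (−1, 1) ↦ (−1, 1)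
    have c1 : eNormal m ⬝ᵥ y ≤ 0 := by rw [eNormal_dotProduct, h0, h1]; norm_num
    have c2 : tNormal m ⬝ᵥ y ≤ 0 := by rw [tNormal_dotProduct, h0, h1]; norm_num
    have hin : canon (eNormal m) 0 y = y := by rw [canon, if_pos c1]
    rw [hin, canon, if_pos c2]
    ext i
    by_cases hi0 : i = 0
    · subst hi0; rw [Function.update_self, h0, h1]; norm_num
    · rw [Function.update_of_ne hi0]
      by_cases hi1 : i = 1
      · subst hi1; rw [Function.update_self, h1]
      · rw [Function.update_of_ne hi1]
  · -- (−1, −1) ↦ ρτ: (1, 1)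
    have c1 : ¬ eNormal m ⬝ᵥ y ≤ 0 := by rw [eNormal_dotProduct, h0, h1]; norm_num
    have c2 : tNormal m ⬝ᵥ Function.update (Function.update y 1 (-y 0)) 0 (-y 1) ≤ 0 := by
      rw [tNormal_dotProduct, Function.update_self, Function.update_of_ne hne, Function.update_self,
        h0, h1]
      norm_num
    have hin : canon (eNormal m) 0 y = Function.update (Function.update y 1 (-y 0)) 0 (-y 1) := by
      rw [canon, if_neg c1, reflectAt_eNormal]
    rw [hin, canon, if_pos c2]
    ext i
    by_cases hi0 : i = 0
    · subst hi0; rw [Function.update_self, Function.update_self, h0, h1]; norm_num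
    · rw [Function.update_of_ne hi0, Function.update_of_ne hi0]
      by_cases hi1 : i = 1
      · subst hi1; rw [Function.update_self, Function.update_self, h0]; norm_num
      · rw [Function.update_of_ne hi1, Function.update_of_ne hi1]

/-! ### Lifting relations by one leading coordinate, and the sequence `(E_{1,2}, …, E_{n−1,n})` -/

/-- Prepend a zero coordinate to the normal vector: the relation acts on coordinates `2, …, n`.
[cite: KaibelPashkovich2011, Prop. 7 (arXiv p. 11: the pairs `E_{1,2}, …, E_{n−1,n}`)] -/
def liftRel (h : (Fin (m + 1) → ℝ) × ℝ) : (Fin (m + 2) → ℝ) × ℝ := (Fin.cons 0 h.1, h.2)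

/-- `⟨(0, a), w⟩ = ⟨a, tail w⟩`. [cite: KaibelPashkovich2011, §3 (arXiv p. 7)] -/
theorem cons_zero_dotProduct (a : Fin (m + 1) → ℝ) (w : Fin (m + 2) → ℝ) :
    (Fin.cons 0 a : Fin (m + 2) → ℝ) ⬝ᵥ w = a ⬝ᵥ Fin.tail w := by
  simp [dotProduct, Fin.sum_univ_succ, Fin.tail]

/-- A lifted reflection fixes the leading coordinate and reflects the tail.
[cite: KaibelPashkovich2011, §3 (arXiv p. 7)] -/
theorem reflectAt_cons_zero (a : Fin (m + 1) → ℝ) (β : ℝ) (w : Fin (m + 2) → ℝ) :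
    reflectAt (Fin.cons 0 a) β w = Fin.cons (w 0) (reflectAt a β (Fin.tail w)) := by
  have h1 := cons_zero_dotProduct a w
  have h2 : (Fin.cons 0 a : Fin (m + 2) → ℝ) ⬝ᵥ (Fin.cons 0 a : Fin (m + 2) → ℝ) = a ⬝ᵥ a := by
    rw [cons_zero_dotProduct, Fin.tail_cons]
  ext i
  rw [reflectAt, reflectAt, h1, h2]
  refine Fin.cases ?_ (fun j => ?_) i
  · simp
  · simp [Fin.tail]

/-- A lifted canonical map fixes the leading coordinate. [cite: KaibelPashkovich2011, §3 eq. (3) (arXiv p. 7)] -/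
theorem canon_cons_zero (a : Fin (m + 1) → ℝ) (β : ℝ) (w : Fin (m + 2) → ℝ) :
    canon (Fin.cons 0 a) β w = Fin.cons (w 0) (canon a β (Fin.tail w)) := by
  by_cases h : a ⬝ᵥ Fin.tail w ≤ β
  · rw [canon, if_pos (by rwa [cons_zero_dotProduct]), canon, if_pos h, Fin.cons_self_tail]
  · rw [canon, if_neg (by rwa [cons_zero_dotProduct]), canon, if_neg h, reflectAt_cons_zero]

/-- The composite canonical map of a lifted sequence fixes the leading coordinate.
[cite: KaibelPashkovich2011, §3 eq. (3) (arXiv p. 7)] -/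
theorem canonSeq_map_liftRel (l : List ((Fin (m + 1) → ℝ) × ℝ)) (w : Fin (m + 2) → ℝ) :
    canonSeq (l.map liftRel) w = Fin.cons (w 0) (canonSeq l (Fin.tail w)) := by
  induction l with
  | nil => simp [canonSeq]
  | cons h t ih =>
    rw [List.map_cons, canonSeq, canonSeq, ih]
    show canon (Fin.cons 0 h.1) h.2 _ = _
    rw [canon_cons_zero, Fin.cons_zero, Fin.tail_cons]

/-- **The sequence `(E_{1,2}, E_{2,3}, …, E_{m,m+1})`** of reflection relations on `ℝ^{m+1}`:
`E_{1,2} = (R_{e_1−e_2,0}, R_{−e_1−e_2,0})` followed by the sequence for the coordinates `2, …, m+1`.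
[cite: KaibelPashkovich2011, Prop. 7 (arXiv p. 11)] -/
def paritySeq : (m : ℕ) → List ((Fin (m + 1) → ℝ) × ℝ)
  | 0 => []
  | m + 1 => (tNormal m, 0) :: (eNormal m, 0) :: (paritySeq m).map liftRel

/-- The sequence has `2m = 2(n − 1)` relations. [cite: KaibelPashkovich2011, §4.1.4 (arXiv p. 11: "`2(n−1)` variables and `4(n−1)` inequalities")] -/
theorem length_paritySeq : ∀ m : ℕ, (paritySeq m).length = 2 * m
  | 0 => rfl
  | m + 1 => by simp [paritySeq, length_paritySeq m]; ring

/-- **Proposition 7 (its computational core, for the two one-point polytopes):**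
`η*_{1,2} ∘ ⋯ ∘ η*_{n−1,n}(w) = (∏_i w_i, 1, …, 1)` for `w ∈ {−1,+1}ⁿ` — i.e. `𝟙` if `w` has an even number
of minus signs and `(−1, 1, …, 1)` otherwise ("the point `Φ_{D_n}(x)` arises from `|x|↑` by multiplying
the first component by `−1` in case `x` has an odd number of negative components").
[cite: KaibelPashkovich2011, Prop. 7, proof (arXiv p. 11)] -/
theorem canonSeq_paritySeq : ∀ (m : ℕ) (w : Fin (m + 1) → ℝ), IsSignVec w →
    canonSeq (paritySeq m) w = Function.update (fun _ => (1 : ℝ)) 0 (∏ i, w i)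
  | 0, w, _ => by
      ext i
      have hi : i = 0 := Fin.fin_one_eq_zero i
      subst hi
      simp [paritySeq, canonSeq]
  | m + 1, w, hw => by
      have htail : IsSignVec (Fin.tail w) := fun i => hw i.succ
      rw [paritySeq, canonSeq, canonSeq, canonSeq_map_liftRel, canonSeq_paritySeq m _ htail]
      set u : Fin (m + 2) → ℝ := Fin.cons (w 0) (Function.update (fun _ => (1 : ℝ)) 0 (∏ i, Fin.tail w i))
        with hu
      have hu0 : u 0 = w 0 := by simp [hu]
      have hu1 : u 1 = ∏ i, Fin.tail w i := by
        rw [hu, show (1 : Fin (m + 2)) = Fin.succ 0 from rfl, Fin.cons_succ, Function.update_self]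
      have hus : ∀ j : Fin m, u j.succ.succ = 1 := by
        intro j
        rw [hu, Fin.cons_succ, Function.update_of_ne (Fin.succ_ne_zero j)]
      rw [etaStar_sign u (hu0 ▸ hw 0) (hu1 ▸ prod_sign htail), Fin.prod_univ_succ, hu0, hu1]
      ext i
      refine Fin.cases ?_ (fun j => ?_) i
      · rw [Function.update_self, Function.update_self]
        rfl
      · rw [Function.update_of_ne (Fin.succ_ne_zero j), Function.update_of_ne (Fin.succ_ne_zero j)]
        refine Fin.cases ?_ (fun k => ?_) j
        · rw [show (Fin.succ 0 : Fin (m + 2)) = 1 from rfl, Function.update_self]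
        · rw [Function.update_of_ne (succ_succ_ne_one_fin k), hus]

/-! ### Invariance: every reflection of the sequence preserves sign vectors and their parity -/

/-- A reflection "of `D_n`-type": it maps sign vectors to sign vectors with the same sign product (the
same parity of the number of minus signs). [cite: KaibelPashkovich2011, §4.1.4 (arXiv p. 11: "`D_n` … changing the signs of an even number of its coordinates")] -/
def PreservesParity (a : Fin n → ℝ) : Prop :=
  ∀ x : Fin n → ℝ, IsSignVec x → IsSignVec (reflectAt a 0 x) ∧ ∏ i, reflectAt a 0 x i = ∏ i, x i

/-- `τ_{1,2}` preserves sign vectors and parity. [cite: KaibelPashkovich2011, §4.1.4 (arXiv p. 11)] -/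
theorem preservesParity_tNormal : PreservesParity (tNormal m) := by
  intro x hx
  rw [reflectAt_tNormal, ← Equiv.comp_swap_eq_update]
  exact ⟨fun i => hx _, Equiv.prod_comp (Equiv.swap 0 1) x⟩

/-- `ρ_{1,2} ∘ τ_{1,2}` preserves sign vectors and parity (two signs change).
[cite: KaibelPashkovich2011, §4.1.4 (arXiv p. 11)] -/
theorem preservesParity_eNormal : PreservesParity (eNormal m) := by
  intro x hx
  rw [reflectAt_eNormal]
  refine ⟨fun i => ?_, ?_⟩
  · by_cases hi0 : i = 0
    · subst hi0
      rw [Function.update_self]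
      rcases hx 1 with h | h <;> rw [h] <;> norm_num
    · rw [Function.update_of_ne hi0]
      by_cases hi1 : i = 1
      · subst hi1
        rw [Function.update_self]
        rcases hx 0 with h | h <;> rw [h] <;> norm_num
      · rw [Function.update_of_ne hi1]
        exact hx i
  · rw [Fin.prod_univ_succ, Fin.prod_univ_succ, Fin.prod_univ_succ x,
      Fin.prod_univ_succ (fun i : Fin (m + 1) => x i.succ)]
    rw [Function.update_self, Function.update_of_ne (Fin.succ_ne_zero 0),
      show (Fin.succ 0 : Fin (m + 2)) = 1 from rfl, Function.update_self]
    have : ∀ j : Fin m, Function.update (Function.update x 1 (-x 0)) 0 (-x 1) j.succ.succ = x j.succ.succ := by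
      intro j
      rw [Function.update_of_ne (Fin.succ_ne_zero _), Function.update_of_ne (succ_succ_ne_one_fin j)]
    simp only [this]
    ring

/-- Lifting preserves the invariant. [cite: KaibelPashkovich2011, §4.1.4 (arXiv p. 11)] -/
theorem PreservesParity.cons_zero {a : Fin (m + 1) → ℝ} (ha : PreservesParity a) :
    PreservesParity (Fin.cons 0 a : Fin (m + 2) → ℝ) := by
  intro x hx
  obtain ⟨h1, h2⟩ := ha (Fin.tail x) fun i => hx i.succ
  rw [reflectAt_cons_zero]
  refine ⟨fun i => Fin.cases (by simpa using hx 0) (fun j => by simpa using h1 j) i, ?_⟩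
  rw [Fin.prod_univ_succ, Fin.prod_univ_succ x]
  simp only [Fin.cons_zero, Fin.cons_succ]
  rw [h2]
  rfl

/-- Every relation of the sequence is a reflection relation `R_{a,0}` with `a ≠ 0` of `D_n`-type.
[cite: KaibelPashkovich2011, Prop. 7, proof (arXiv p. 11: "the first condition of Theorem 1 is satisfied")] -/
theorem paritySeq_spec : ∀ (m : ℕ), ∀ h ∈ paritySeq m, h.1 ≠ 0 ∧ h.2 = 0 ∧ PreservesParity h.1
  | 0, h, hh => by simp [paritySeq] at hh
  | m + 1, h, hh => by
      rw [paritySeq, List.mem_cons, List.mem_cons, List.mem_map] at hh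
      rcases hh with rfl | rfl | ⟨h', hh', rfl⟩
      · exact ⟨tNormal_ne_zero, rfl, preservesParity_tNormal⟩
      · exact ⟨eNormal_ne_zero, rfl, preservesParity_eNormal⟩
      · obtain ⟨h1, h2, h3⟩ := paritySeq_spec m h' hh'
        refine ⟨fun h0 => h1 ?_, h2, h3.cons_zero⟩
        have := congrArg Fin.tail h0
        rw [liftRel, Fin.tail_cons] at this
        exact this

/-- The convex hull of a set of sign vectors of fixed parity is closed under the reflections of the
sequence. [cite: KaibelPashkovich2011, Prop. 7, proof (arXiv p. 11)] -/
theorem reflectAt_mem_convexHull {a : Fin n → ℝ} (ha : PreservesParity a) (s : ℝ) {x : Fin n → ℝ}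
    (hx : x ∈ convexHull ℝ {x | IsSignVec x ∧ ∏ i, x i = s}) :
    reflectAt a 0 x ∈ convexHull ℝ {x | IsSignVec x ∧ ∏ i, x i = s} := by
  set W : Set (Fin n → ℝ) := {x | IsSignVec x ∧ ∏ i, x i = s}
  have himg : reflectAt a 0 '' convexHull ℝ W = convexHull ℝ (reflectAt a 0 '' W) :=
    (reflectLin a).image_convexHull W
  have hsub : reflectAt a 0 '' W ⊆ W := by
    rintro _ ⟨y, ⟨hy, hyp⟩, rfl⟩
    obtain ⟨h1, h2⟩ := ha y hy
    exact ⟨h1, by rw [h2, hyp]⟩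
  have : reflectAt a 0 x ∈ reflectAt a 0 '' convexHull ℝ W := ⟨x, hx, rfl⟩
  rw [himg] at this
  exact convexHull_mono hsub this

/-! ### The two extended formulations with `4(n − 1)` inequalities -/

/-- `𝟙` is constant-sign with product `1`; `(−1, 1, …, 1)` with product `−1`.
[cite: KaibelPashkovich2011, §4.1.4 (arXiv p. 11)] -/
theorem update_one_mem (s : ℝ) (hs : s = 1 ∨ s = -1) :
    Function.update (fun _ : Fin (m + 1) => (1 : ℝ)) 0 s ∈ {x : Fin (m + 1) → ℝ | IsSignVec x ∧ ∏ i, x i = s} := by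
  refine ⟨fun i => ?_, ?_⟩
  · by_cases hi : i = 0
    · subst hi; rw [Function.update_self]; exact hs
    · rw [Function.update_of_ne hi]; exact Or.inl rfl
  · rw [Fin.prod_univ_succ, Function.update_self]
    simp

/-- **Proposition 7 for `P = {(s, 1, …, 1)}`, `s = ±1`**: the sequence `(E_{1,2}, …, E_{n−1,n})` maps the
point onto the convex hull of all sign vectors with sign product `s`.
[cite: KaibelPashkovich2011, Prop. 7 and §4.1.4 (arXiv p. 11)] -/
theorem seqImage_paritySeq (m : ℕ) (s : ℝ) (hs : s = 1 ∨ s = -1) :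
    seqImage (paritySeq m) {Function.update (fun _ : Fin (m + 1) => (1 : ℝ)) 0 s} =
      convexHull ℝ {x : Fin (m + 1) → ℝ | IsSignVec x ∧ ∏ i, x i = s} := by
  apply KaibelPashkovich2011_thm1 (W := {x : Fin (m + 1) → ℝ | IsSignVec x ∧ ∏ i, x i = s}) rfl
    (convex_singleton _)
  · exact Set.singleton_subset_iff.2 (subset_convexHull ℝ _ (update_one_mem s hs))
  · exact fun h hh => (paritySeq_spec m h hh).1
  · intro h hh x hx
    obtain ⟨-, h0, hP⟩ := paritySeq_spec m h hh
    rw [h0]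
    exact reflectAt_mem_convexHull hP s hx
  · rintro w ⟨hw, hwp⟩
    rw [Set.mem_singleton_iff, canonSeq_paritySeq m w hw, hwp]

/-- **The sign vectors with an even number of minus signs: `xc ≤ 4(n − 1)`** (`n = m + 1`).
[cite: KaibelPashkovich2011, §4.1.4 (arXiv p. 11)][cite: CarrKonjevod2005, §2 (parity polytope)] -/
theorem hasEFOfSize_convexHull_signVecsEven (m : ℕ) :
    HasEFOfSize (convexHull ℝ (signVecsEven (m + 1))) (4 * m) := by
  have h := (hasEFOfSize_singleton (Function.update (fun _ : Fin (m + 1) => (1 : ℝ)) 0 1)).seqImage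
    (paritySeq m)
  rw [seqImage_paritySeq m 1 (Or.inl rfl), length_paritySeq, zero_add, ← mul_assoc] at h
  exact h

/-- **The sign vectors with an odd number of minus signs: `xc ≤ 4(n − 1)`** (`n = m + 1`).
[cite: KaibelPashkovich2011, §4.1.4 (arXiv p. 11)][cite: CarrKonjevod2005, §2 (parity polytope)] -/
theorem hasEFOfSize_convexHull_signVecsOdd (m : ℕ) :
    HasEFOfSize (convexHull ℝ (signVecsOdd (m + 1))) (4 * m) := by
  have h := (hasEFOfSize_singleton (Function.update (fun _ : Fin (m + 1) => (1 : ℝ)) 0 (-1))).seqImage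
    (paritySeq m)
  rw [seqImage_paritySeq m (-1) (Or.inr rfl), length_paritySeq, zero_add, ← mul_assoc] at h
  exact h

/-! ### The 0/1 parity polytopes via `y ↦ ½(𝟙 − y)` -/

/-- `{v ∈ {0,1}ⁿ : #{i : v_i = 1} odd}` (`b = true`) resp. even (`b = false`); for 0/1 vectors
`Σ_i v_i = #{i : v_i = 1}` (`sum_eq_card`). [cite: KaibelPashkovich2011, §4.1.4 (arXiv p. 11)] -/
def parityVecs (n : ℕ) (b : Bool) : Set (Fin n → ℝ) :=
  {v | (∀ i, v i = 0 ∨ v i = 1) ∧ (univ.filter fun i => v i = 1).card % 2 = if b then 1 else 0}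

/-- The **parity polytopes** `conv{v ∈ {0,1}ⁿ : Σ_i v_i odd}` (`b = true`) and `conv{… even}`
(`b = false`). [cite: KaibelPashkovich2011, §4.1.4 (arXiv p. 11)][cite: CarrKonjevod2005, §2] -/
def parityPolytope (n : ℕ) (b : Bool) : Set (Fin n → ℝ) := convexHull ℝ (parityVecs n b)

/-- For `v ∈ {0,1}ⁿ`, `Σ_i v_i = #{i : v_i = 1}`. [cite: KaibelPashkovich2011, §4.1.4 (arXiv p. 11)] -/
theorem sum_eq_card {v : Fin n → ℝ} (hv : ∀ i, v i = 0 ∨ v i = 1) :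
    ∑ i, v i = ((univ.filter fun i => v i = 1).card : ℝ) := by
  have : ∀ i ∈ (univ : Finset (Fin n)), v i = if v i = 1 then 1 else 0 := by
    intro i _
    rcases hv i with h | h
    · rw [h]; norm_num
    · rw [h]; norm_num
  rw [Finset.sum_congr rfl this, Finset.sum_ite, Finset.sum_const_zero, add_zero, Finset.sum_const,
    nsmul_eq_mul, mul_one]

/-- The affine map `y ↦ ½(𝟙 − y)`. [cite: KaibelPashkovich2011, §4.1.4 (arXiv p. 11)] -/
def halfFlip (n : ℕ) : (Fin n → ℝ) →ᵃ[ℝ] (Fin n → ℝ) where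
  toFun y := fun i => (1 - y i) / 2
  linear := (-(1 / 2 : ℝ)) • LinearMap.id
  map_vadd' p v := by
    ext i
    simp only [vadd_eq_add, Pi.add_apply, LinearMap.smul_apply, LinearMap.id_coe, id_eq,
      Pi.smul_apply, smul_eq_mul]
    ring

/-- `halfFlip y = ½(𝟙 − y)` coordinatewise. [cite: KaibelPashkovich2011, §4.1.4 (arXiv p. 11)] -/
@[simp] theorem halfFlip_apply (y : Fin n → ℝ) (i : Fin n) : halfFlip n y i = (1 - y i) / 2 := rfl

/-- `halfFlip` as "linear map plus constant", the shape of `HasEFOfSize.image_affine`.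
[cite: KaibelPashkovich2011, §4.1.4 (arXiv p. 11)] -/
theorem halfFlip_eq (y : Fin n → ℝ) :
    halfFlip n y = ((-(1 / 2 : ℝ)) • LinearMap.id (R := ℝ) (M := Fin n → ℝ)) y + fun _ => 1 / 2 := by
  ext i
  simp only [halfFlip_apply, Pi.add_apply, LinearMap.smul_apply, LinearMap.id_coe, id_eq,
    Pi.smul_apply, smul_eq_mul]
  ring

/-- `y ↦ ½(𝟙 − y)` maps the sign vectors with sign product `−1` (odd number of `−1`) onto the 0/1
vectors with an odd number of ones, and those with product `1` onto those with an even number of ones.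
[cite: KaibelPashkovich2011, §4.1.4 (arXiv p. 11)] -/
theorem halfFlip_image_signVecs (n : ℕ) (b : Bool) :
    halfFlip n '' {x : Fin n → ℝ | IsSignVec x ∧ ∏ i, x i = if b then -1 else 1} = parityVecs n b := by
  ext v
  simp only [Set.mem_image, Set.mem_setOf_eq, parityVecs]
  constructor
  · rintro ⟨y, ⟨hy, hyp⟩, rfl⟩
    have h01 : ∀ i, halfFlip n y i = 0 ∨ halfFlip n y i = 1 := by
      intro i
      rcases hy i with h | h
      · left; rw [halfFlip_apply, h]; norm_num
      · right; rw [halfFlip_apply, h]; norm_num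
    refine ⟨h01, ?_⟩
    have hset : (univ.filter fun i => halfFlip n y i = 1) = univ.filter fun i => y i = -1 := by
      ext i
      simp only [Finset.mem_filter, Finset.mem_univ, true_and, halfFlip_apply]
      constructor
      · intro h; linarith
      · intro h; rw [h]; norm_num
    rw [hset]
    rw [prod_eq_neg_one_pow hy] at hyp
    cases b
    · simp only [Bool.false_eq_true, ↓reduceIte] at hyp ⊢
      exact Nat.even_iff.1 ((neg_one_pow_eq_one_iff_even (by norm_num)).1 hyp)
    · simp only [↓reduceIte] at hyp ⊢
      rcases Nat.even_or_odd (univ.filter fun i => y i = -1).card with h | h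
      · rw [h.neg_one_pow] at hyp; norm_num at hyp
      · exact Nat.odd_iff.1 h
  · rintro ⟨hv, hcard⟩
    refine ⟨fun i => 1 - 2 * v i, ⟨fun i => ?_, ?_⟩, ?_⟩
    · rcases hv i with h | h
      · left; simp only [h]; norm_num
      · right; simp only [h]; norm_num
    · have hy : IsSignVec fun i => 1 - 2 * v i := by
        intro i
        rcases hv i with h | h
        · left; simp only [h]; norm_num
        · right; simp only [h]; norm_num
      rw [prod_eq_neg_one_pow hy]
      have hset : (univ.filter fun i => 1 - 2 * v i = (-1 : ℝ)) = univ.filter fun i => v i = 1 := by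
        ext i
        simp only [Finset.mem_filter, Finset.mem_univ, true_and]
        constructor
        · intro h; linarith
        · intro h; rw [h]; norm_num
      rw [hset]
      cases b
      · simp only [Bool.false_eq_true, ↓reduceIte] at hcard ⊢
        exact (Nat.even_iff.2 hcard).neg_one_pow
      · simp only [↓reduceIte] at hcard ⊢
        exact (Nat.odd_iff.2 hcard).neg_one_pow
    · ext i
      rw [halfFlip_apply]
      ring

/-- **The parity polytopes have extended formulations with `4(n − 1)` inequalities** (`n = m + 1 ≥ 1`;
Carr–Konjevod, reproved by Kaibel–Pashkovich through `D_n`-reflections).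
[cite: KaibelPashkovich2011, §4.1.4 (arXiv p. 11)][cite: CarrKonjevod2005, §2 (parity polytope)] -/
theorem hasEFOfSize_parityPolytope (m : ℕ) (b : Bool) :
    HasEFOfSize (parityPolytope (m + 1) b) (4 * m) := by
  set s : ℝ := if b then -1 else 1 with hs
  have hs' : s = 1 ∨ s = -1 := by cases b <;> simp [hs]
  -- the `±1` polytope with sign product `s`
  have h0 : HasEFOfSize (convexHull ℝ {x : Fin (m + 1) → ℝ | IsSignVec x ∧ ∏ i, x i = s}) (4 * m) := by
    have h := (hasEFOfSize_singleton (Function.update (fun _ : Fin (m + 1) => (1 : ℝ)) 0 s)).seqImage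
      (paritySeq m)
    rw [seqImage_paritySeq m s hs', length_paritySeq, zero_add, ← mul_assoc] at h
    exact h
  have h1 := h0.image_affine ((-(1 / 2 : ℝ)) • LinearMap.id) (fun _ => (1 / 2 : ℝ))
  have himg : (fun x : Fin (m + 1) → ℝ => ((-(1 / 2 : ℝ)) • LinearMap.id (R := ℝ) (M := Fin (m + 1) → ℝ)) x +
      fun _ => (1 / 2 : ℝ)) = halfFlip (m + 1) := by
    funext y
    exact (halfFlip_eq y).symm
  rw [himg, AffineMap.image_convexHull, halfFlip_image_signVecs] at h1
  exact h1

/-! ### Lower bound: `xc ≥ n − 1` by Goemans' face counting -/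

/-- A sign vector is the unique maximiser of `⟨x, ·⟩` over sign vectors, hence an extreme point of the
hull of any set of sign vectors containing it. [cite: Goemans2015, Thm. 1 (§2)] -/
theorem signVec_mem_extremePoints {S : Set (Fin n → ℝ)} (hS : ∀ x ∈ S, IsSignVec x) {x : Fin n → ℝ}
    (hx : x ∈ S) : x ∈ (convexHull ℝ S).extremePoints ℝ := by
  refine mem_extremePoints_convexHull_of_dotProduct_lt (c := x) hx fun q hq hne => ?_
  -- `⟨x, q⟩ < ⟨x, x⟩`: termwise `x_i q_i ≤ 1 = x_i x_i`, strictly somewhere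
  have hle : ∀ i, x i * q i ≤ x i * x i := by
    intro i
    rcases hS x hx i with h | h <;> rcases hS q hq i with h' | h' <;> rw [h, h'] <;> norm_num
  obtain ⟨i, hi⟩ : ∃ i, q i ≠ x i := by
    by_contra hall
    push Not at hall
    exact hne (funext hall)
  have hlt : x i * q i < x i * x i := by
    rcases hS x hx i with h | h <;> rcases hS q hq i with h' | h'
    · exact absurd (h'.trans h.symm) hi
    · rw [h, h']; norm_num
    · rw [h, h']; norm_num
    · exact absurd (h'.trans h.symm) hi
  exact Finset.sum_lt_sum (fun j _ => hle j) ⟨i, Finset.mem_univ i, hlt⟩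

/-- The sign vector with prescribed tail signs `b` and sign product `s`.
[cite: KaibelPashkovich2011, §4.1.4 (arXiv p. 11)] -/
def signVecOf (s : ℝ) (b : Fin m → Bool) : Fin (m + 1) → ℝ :=
  Fin.cons (s * ∏ i, (if b i then (-1 : ℝ) else 1)) fun i => if b i then -1 else 1

/-- `signVecOf s b` is a sign vector with product `s`. [cite: KaibelPashkovich2011, §4.1.4 (arXiv p. 11)] -/
theorem signVecOf_mem (s : ℝ) (hs : s = 1 ∨ s = -1) (b : Fin m → Bool) :
    signVecOf s b ∈ {x : Fin (m + 1) → ℝ | IsSignVec x ∧ ∏ i, x i = s} := by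
  have htail : IsSignVec fun i : Fin m => if b i then (-1 : ℝ) else 1 := by
    intro i; by_cases hb : b i <;> simp [hb]
  have hp := prod_sign htail
  have h0 : signVecOf s b 0 = s * ∏ i, (if b i then (-1 : ℝ) else 1) := by simp [signVecOf]
  have hsucc : ∀ j : Fin m, signVecOf s b j.succ = if b j then -1 else 1 := by
    intro j; simp [signVecOf]
  refine ⟨fun i => Fin.cases ?zero (fun j => ?succ) i, ?prod⟩
  case zero =>
    rw [h0]
    rcases hs with rfl | rfl <;> rcases hp with h | h <;> rw [h] <;> norm_num
  case succ =>
    rw [hsucc]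
    exact htail j
  case prod =>
    rw [Fin.prod_univ_succ, h0]
    simp only [hsucc]
    rcases hp with h | h <;> rw [h] <;> ring

/-- Different tails give different sign vectors. [cite: KaibelPashkovich2011, §4.1.4 (arXiv p. 11)] -/
theorem signVecOf_injective (s : ℝ) : Function.Injective (signVecOf (m := m) s) := by
  intro b b' h
  funext i
  have := congrFun h i.succ
  simp only [signVecOf, Fin.cons_succ] at this
  by_cases hb : b i <;> by_cases hb' : b' i <;> simp [hb, hb'] at this ⊢ <;> norm_num at this

/-- **Lower bound: every EF of the hull of the `2^{n−1}` sign vectors of fixed parity has at least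
`n − 1` inequalities** (`2^{n−1}` vertices `≤ 2^r` faces, Goemans).
[cite: Goemans2015, Thm. 1 (§2)][cite: KaibelPashkovich2011, §4.1.4 (arXiv p. 11)] -/
theorem le_of_hasEFOfSize_signVecs (s : ℝ) (hs : s = 1 ∨ s = -1) {r : ℕ}
    (h : HasEFOfSize (convexHull ℝ {x : Fin (m + 1) → ℝ | IsSignVec x ∧ ∏ i, x i = s}) r) : m ≤ r := by
  classical
  set S : Set (Fin (m + 1) → ℝ) := {x | IsSignVec x ∧ ∏ i, x i = s}
  haveI : Finite ((convexHull ℝ S).extremePoints ℝ) := h.finite_extremePoints.to_subtype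
  let f : (Fin m → Bool) → (convexHull ℝ S).extremePoints ℝ := fun b =>
    ⟨signVecOf s b, signVec_mem_extremePoints (fun x hx => hx.1) (signVecOf_mem s hs b)⟩
  have hf : Function.Injective f := fun b b' hbb' =>
    signVecOf_injective s (congrArg Subtype.val hbb')
  have hcard : 2 ^ m ≤ 2 ^ r :=
    calc 2 ^ m = Nat.card (Fin m → Bool) := by simp
      _ ≤ Nat.card ((convexHull ℝ S).extremePoints ℝ) := Nat.card_le_card_of_injective f hf
      _ ≤ 2 ^ r := h.natCard_extremePoints_le
  exact (Nat.pow_le_pow_iff_right (by norm_num)).1 hcard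

/-- `xc(conv signVecsEven (m+1)) ≥ m`. [cite: Goemans2015, Thm. 1 (§2)] -/
theorem le_of_hasEFOfSize_signVecsEven {r : ℕ} (h : HasEFOfSize (convexHull ℝ (signVecsEven (m + 1))) r) :
    m ≤ r :=
  le_of_hasEFOfSize_signVecs 1 (Or.inl rfl) h

/-- `xc(conv signVecsOdd (m+1)) ≥ m`. [cite: Goemans2015, Thm. 1 (§2)] -/
theorem le_of_hasEFOfSize_signVecsOdd {r : ℕ} (h : HasEFOfSize (convexHull ℝ (signVecsOdd (m + 1))) r) :
    m ≤ r :=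
  le_of_hasEFOfSize_signVecs (-1) (Or.inr rfl) h

/-- The inverse affine map `v ↦ 𝟙 − 2v` of `y ↦ ½(𝟙 − y)`. [cite: KaibelPashkovich2011, §4.1.4 (arXiv p. 11)] -/
def doubleFlip (n : ℕ) : (Fin n → ℝ) →ᵃ[ℝ] (Fin n → ℝ) where
  toFun v := fun i => 1 - 2 * v i
  linear := (-(2 : ℝ)) • LinearMap.id
  map_vadd' p v := by
    ext i
    simp only [vadd_eq_add, Pi.add_apply, LinearMap.smul_apply, LinearMap.id_coe, id_eq,
      Pi.smul_apply, smul_eq_mul]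
    ring

/-- `doubleFlip v = 𝟙 − 2v` coordinatewise. [cite: KaibelPashkovich2011, §4.1.4 (arXiv p. 11)] -/
@[simp] theorem doubleFlip_apply (v : Fin n → ℝ) (i : Fin n) : doubleFlip n v i = 1 - 2 * v i := rfl

/-- `doubleFlip` in the shape of `HasEFOfSize.image_affine`. [cite: KaibelPashkovich2011, §4.1.4 (arXiv p. 11)] -/
theorem doubleFlip_eq (v : Fin n → ℝ) :
    doubleFlip n v = ((-(2 : ℝ)) • LinearMap.id (R := ℝ) (M := Fin n → ℝ)) v + fun _ => 1 := by
  ext i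
  simp only [doubleFlip_apply, Pi.add_apply, LinearMap.smul_apply, LinearMap.id_coe, id_eq,
    Pi.smul_apply, smul_eq_mul]
  ring

/-- `𝟙 − 2 · ½(𝟙 − y) = y`. [cite: KaibelPashkovich2011, §4.1.4 (arXiv p. 11)] -/
@[simp] theorem doubleFlip_halfFlip (y : Fin n → ℝ) : doubleFlip n (halfFlip n y) = y := by
  ext i
  rw [doubleFlip_apply, halfFlip_apply]
  ring

/-- Back from `{0,1}` to `{−1,+1}`: `v ↦ 𝟙 − 2v` maps the 0/1 vectors with an odd (even) number of ones
onto the sign vectors with sign product `−1` (`1`). [cite: KaibelPashkovich2011, §4.1.4 (arXiv p. 11)] -/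
theorem doubleFlip_image_parityVecs (n : ℕ) (b : Bool) :
    doubleFlip n '' parityVecs n b = {x : Fin n → ℝ | IsSignVec x ∧ ∏ i, x i = if b then -1 else 1} := by
  rw [← halfFlip_image_signVecs, Set.image_image]
  simp only [doubleFlip_halfFlip, Set.image_id']

/-- **Lower bound for the parity polytopes: every extended formulation of `conv{v ∈ {0,1}ⁿ : Σ v_i odd}`
(or even) has at least `n − 1` inequalities** (`n = m + 1`); together with `hasEFOfSize_parityPolytope`:
`n − 1 ≤ xc ≤ 4(n − 1)`. [cite: Goemans2015, Thm. 1 (§2)][cite: KaibelPashkovich2011, §4.1.4 (arXiv p. 11)] -/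
theorem le_of_hasEFOfSize_parityPolytope (m : ℕ) (b : Bool) {r : ℕ}
    (h : HasEFOfSize (parityPolytope (m + 1) b) r) : m ≤ r := by
  have h1 := h.image_affine ((-(2 : ℝ)) • LinearMap.id) (fun _ => (1 : ℝ))
  have hfun : (fun x : Fin (m + 1) → ℝ => ((-(2 : ℝ)) • LinearMap.id (R := ℝ) (M := Fin (m + 1) → ℝ)) x +
      fun _ => (1 : ℝ)) = doubleFlip (m + 1) := by
    funext v
    exact (doubleFlip_eq v).symm
  rw [hfun, parityPolytope, AffineMap.image_convexHull, doubleFlip_image_parityVecs] at h1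
  cases b
  · exact le_of_hasEFOfSize_signVecs 1 (Or.inl rfl) (by simpa using h1)
  · exact le_of_hasEFOfSize_signVecs (-1) (Or.inr rfl) (by simpa using h1)

end ParityPolytope

end Literature.Combinatorics.Optimization

end
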